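import Literature.Computability.QuantumComplexity.CircuitEmbedding
import Literature.Computability.QuantumComplexity.HybridArgument
import HarnessLib

/-!
# Product states over disjoint blocks: norms and the factorwise distance bound

Topic `Literature/Computability/QuantumComplexity`, a complement to `CircuitEmbedding.lean`
(`prodState E φ c = |c|_{off}⟩ ⊗ ⨂ᵢ φᵢ` for pairwise disjoint blocks `E i : Fin b ↪ Fin W`). When
independent sub-circuits prepare the factors of a product state each up to an `ℓ²` error
(`toMatrix_flatMap_mapWires_mulVec_prodState`), the errors add — the elementary hybrid estimate
`‖⨂ φᵢ − ⨂ φ'ᵢ‖₂ ≤ Σᵢ ‖φᵢ − φ'ᵢ‖₂` for factors of norm `≤ 1` (Bernstein–Vazirani 1997, §8;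
Nielsen–Chuang 2010, Box 4.1 "errors add at most linearly"). Used by the analysis of Regev's quantum
sampler (Regev 2009, Lemma 3.12: "Repeating the procedure described above `n` times creates … the
`n`-fold tensor product"). Contents, all proved:

* `prod_apply_update` — `∏ᵢ F i (update ψ j δ i) = F j δ · ∏_{i ≠ j} F i (ψ i)`;
* `prodState_update_sub` — `prodState` is additive in each factor;
* `normSq_prodState`, `l2Norm_prodState` — `‖⨂ φᵢ‖₂ = ∏ᵢ ‖φᵢ‖₂` (from `sum_normSq_prodState_mul`);
* **`l2Norm_prodState_sub_prodState_le`** — `‖⨂ φᵢ − ⨂ φ'ᵢ‖₂ ≤ Σᵢ ‖φᵢ − φ'ᵢ‖₂` when all `‖φᵢ‖₂, ‖φ'ᵢ‖₂ ≤ 1`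
  (switch the factors one at a time).

## References

* E. Bernstein, U. Vazirani, *Quantum complexity theory*, SIAM J. Comput. 26 (1997), §8
  [BennettBernsteinBrassardVazirani1997].
* M. A. Nielsen, I. L. Chuang, *Quantum Computation and Quantum Information*, CUP 2010, §2.1.7,
  Box 4.1 [NielsenChuang2010].
* O. Regev, *On lattices, learning with errors, random linear codes, and cryptography*, J. ACM 56
  (2009), art. 34, Lemma 3.12 (proof) [Regev2009].
-/

noncomputable section

open Matrix Finset

namespace Literature.Computability.QuantumComplexity

open Cryptography

variable {b W m : ℕ}

/-- **Splitting a product at an updated index**: `∏ᵢ F i (update ψ j δ i) = F j δ · ∏_{i ≠ j} F i (ψ i)`.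
[folklore] -/
theorem prod_apply_update {M : Type*} [CommMonoid M] {α : Type*} (F : Fin m → α → M) (ψ : Fin m → α) (j : Fin m) (δ : α) :
    ∏ i, F i (Function.update ψ j δ i) = F j δ * ∏ i ∈ univ.erase j, F i (ψ i) := by
  rw [← Finset.mul_prod_erase _ _ (mem_univ j), Function.update_self]
  congr 1
  exact prod_congr rfl fun i hi => by rw [Function.update_of_ne (ne_of_mem_erase hi)]

/-- **`prodState` is additive in each factor**:
`⨂(…, ψ, …) − ⨂(…, ψ', …) = ⨂(…, ψ − ψ', …)`. [cite: NielsenChuang2010, §2.1.7] -/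
theorem prodState_update_sub (E : Fin m → (Fin b ↪ Fin W)) (φ : Fin m → QReg b → ℂ) (j : Fin m)
    (ψ ψ' : QReg b → ℂ) (c : QReg W) :
    prodState E (Function.update φ j ψ) c - prodState E (Function.update φ j ψ') c =
      prodState E (Function.update φ j (ψ - ψ')) c := by
  funext z
  simp only [Pi.sub_apply, prodState_apply]
  rw [prod_apply_update (fun i (χ : QReg b → ℂ) => χ (z ∘ E i)) φ j ψ,
    prod_apply_update (fun i (χ : QReg b → ℂ) => χ (z ∘ E i)) φ j ψ',
    prod_apply_update (fun i (χ : QReg b → ℂ) => χ (z ∘ E i)) φ j (ψ - ψ')]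
  simp only [Pi.sub_apply]
  ring

/-- **`normSq (⨂ φᵢ) = ∏ᵢ normSq φᵢ`** for pairwise disjoint blocks. [cite: NielsenChuang2010, §2.2.8] -/
theorem normSq_prodState {E : Fin m → (Fin b ↪ Fin W)} (hE : BlockDisjoint E) (φ : Fin m → QReg b → ℂ) (c : QReg W) :
    Cryptography.normSq (prodState E φ c) = ∏ i, Cryptography.normSq (φ i) := by
  classical
  unfold Cryptography.normSq
  have h := sum_normSq_prodState_mul hE φ c (fun _ => 1)
  simp only [mul_one] at h
  rw [h]
  exact (Fintype.prod_sum (fun i (v : QReg b) => ‖φ i v‖ ^ 2)).symm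

/-- **`‖⨂ φᵢ‖₂ = ∏ᵢ ‖φᵢ‖₂`** for pairwise disjoint blocks. [cite: NielsenChuang2010, §2.2.8] -/
theorem l2Norm_prodState {E : Fin m → (Fin b ↪ Fin W)} (hE : BlockDisjoint E) (φ : Fin m → QReg b → ℂ) (c : QReg W) :
    l2Norm (prodState E φ c) = ∏ i, l2Norm (φ i) := by
  have h1 : l2Norm (prodState E φ c) ^ 2 = (∏ i, l2Norm (φ i)) ^ 2 := by
    rw [l2Norm_sq, normSq_prodState hE, ← Finset.prod_pow]
    exact prod_congr rfl fun i _ => (l2Norm_sq (φ i)).symm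
  exact (pow_left_inj₀ (l2Norm_nonneg _) (prod_nonneg fun i _ => l2Norm_nonneg _) two_ne_zero).1 h1

/-- **Factorwise distance bound (hybrid argument over the blocks)**: for pairwise disjoint blocks and
factors of norm at most one, `‖⨂ φᵢ − ⨂ φ'ᵢ‖₂ ≤ Σᵢ ‖φᵢ − φ'ᵢ‖₂`.
[cite: BennettBernsteinBrassardVazirani1997, §8] [cite: NielsenChuang2010, Box 4.1] -/
theorem l2Norm_prodState_sub_prodState_le {E : Fin m → (Fin b ↪ Fin W)} (hE : BlockDisjoint E)
    {φ φ' : Fin m → QReg b → ℂ} (hφ : ∀ i, l2Norm (φ i) ≤ 1) (hφ' : ∀ i, l2Norm (φ' i) ≤ 1) (c : QReg W) :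
    l2Norm (prodState E φ c - prodState E φ' c) ≤ ∑ i, l2Norm (φ i - φ' i) := by
  classical
  -- switch the factors in `S` from `φ` to `φ'`
  set sw : Finset (Fin m) → Fin m → QReg b → ℂ := fun S i => if i ∈ S then φ' i else φ i with hsw
  have hsw1 : ∀ S i, l2Norm (sw S i) ≤ 1 := fun S i => by
    simp only [hsw]; split_ifs
    · exact hφ' i
    · exact hφ i
  suffices h : ∀ S : Finset (Fin m), l2Norm (prodState E φ c - prodState E (sw S) c) ≤ ∑ i ∈ S, l2Norm (φ i - φ' i) by
    have hu := h univ
    have hswu : sw univ = φ' := by funext i; simp [hsw]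
    rwa [hswu] at hu
  intro S
  induction S using Finset.induction_on with
  | empty =>
    have hsw0 : sw ∅ = φ := by funext i; simp [hsw]
    rw [hsw0, sub_self, l2Norm_zero, sum_empty]
  | @insert j S hj ih =>
    have hstep : sw (insert j S) = Function.update (sw S) j (φ' j) := by
      funext i
      by_cases hij : i = j
      · subst hij; simp [hsw]
      · rw [Function.update_of_ne hij]; simp [hsw, Finset.mem_insert, hij]
    have hswj : sw S j = φ j := by simp [hsw, hj]
    have hbase : prodState E (sw S) c = prodState E (Function.update (sw S) j (φ j)) c := by
      rw [← hswj, Function.update_eq_self]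
    have hone : l2Norm (prodState E (sw S) c - prodState E (sw (insert j S)) c) ≤ l2Norm (φ j - φ' j) := by
      rw [hstep, hbase, prodState_update_sub]
      refine l2Norm_le_of_normSq_le (l2Norm_nonneg _) ?_
      rw [normSq_prodState hE, prod_apply_update (fun _ (χ : QReg b → ℂ) => Cryptography.normSq χ) (sw S) j (φ j - φ' j),
        l2Norm_sq]
      refine mul_le_of_le_one_right (normSq_nonneg _) (prod_le_one (fun i _ => normSq_nonneg _) fun i _ => ?_)
      rw [← l2Norm_sq]
      exact pow_le_one₀ (l2Norm_nonneg _) (hsw1 S i)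
    calc l2Norm (prodState E φ c - prodState E (sw (insert j S)) c)
        ≤ l2Norm (prodState E φ c - prodState E (sw S) c) + l2Norm (prodState E (sw S) c - prodState E (sw (insert j S)) c) :=
          l2Norm_sub_le _ _ _
      _ ≤ ∑ i ∈ S, l2Norm (φ i - φ' i) + l2Norm (φ j - φ' j) := add_le_add ih hone
      _ = ∑ i ∈ insert j S, l2Norm (φ i - φ' i) := by rw [sum_insert hj, add_comm]

end Literature.Computability.QuantumComplexity

end
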